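import Mathlib.Analysis.SpecialFunctions.Complex.LogDeriv
import Mathlib.Analysis.SpecialFunctions.Complex.Arg
import Mathlib.Analysis.SpecialFunctions.Pow.Deriv
import Mathlib.Analysis.SpecialFunctions.Trigonometric.Basic
import Literature.Probability.LatticeModels.IsoradialPercolation
import HarnessLib

/-!
# Stub `stub_angleMap` of line `birth`, crux `CardyWickAnisotropy.AnisotropicBoxCardy`
(stmt-CriticalPhenomena-14309): the weight-to-modulus dictionary is a holomorphic map `D → ℍ`

With `p = criticalWeight (α/2) = sin(α/3)/(sin(α/3) + sin((π-α)/3))` (`tan(α/3) = √3 p/(2-p)`) the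
aspect datum `i·cot(α/2)` extends to a holomorphic map of `D = ball (1/2) (1/2)` into `ℍ`:
`M(p) = (1 - p ω̄)/(1 - p ω)`, `ω = e^{iπ/3}`, satisfies `|M(p) - 2ω|² < 3 ⟺ |p - 1/2| < 1/2`, so
`0 < arg M < 2π/3` on `D`; `E = M^{3/2} = exp ((3/2) log M)` has `0 < im E`, and
`T = (1 + E)/(1 - E)` has `im T = 2 im E/|1 - E|² > 0`; on the segment `M = e^{2iα/3}`, `E = e^{iα}`,
`T = i cot(α/2)`.

Implementation: `ω = ⟨1/2, √3/2⟩`, `ω̄ = ⟨1/2, -(√3/2)⟩` are written out explicitly (no auxiliary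
definitions); `E = R³` with `R = exp (log M / 2)` the principal square root of `M` (so `E = M^{3/2}`),
and `0 < im E` is proved purely algebraically: with `R = u + iv`, `u, v > 0`,
`√3 re M + im M = (√3 u - v)(u + √3 v) > 0` forces `√3 u > v`, whence
`im E = v (√3 u - v)(√3 u + v) > 0`.
-/

namespace Summit.CriticalPhenomena.CardyFormulaZ2.Theorems

/-- `√3 ^ 2 = 3`. -/
private lemma sqrt3_sq : Real.sqrt 3 ^ 2 = 3 := Real.sq_sqrt (by norm_num)

/-- Points `p = x + iy` of `D = ball (1/2) (1/2)` satisfy `x² + y² < x`. -/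
private lemma am_ball {p : ℂ} (hp : p ∈ Metric.ball ((1:ℂ) / 2) (1 / 2)) :
    p.re ^ 2 + p.im ^ 2 < p.re := by
  rw [Metric.mem_ball, Complex.dist_eq] at hp
  have h0 : 0 ≤ ‖p - 1 / 2‖ := norm_nonneg _
  have h1 : ‖p - 1 / 2‖ ^ 2 < 1 / 4 := by nlinarith
  rw [Complex.sq_norm, Complex.normSq_apply] at h1
  have hre : (p - 1 / 2 : ℂ).re = p.re - 1 / 2 := by simp
  have him : (p - 1 / 2 : ℂ).im = p.im := by simp
  rw [hre, him] at h1
  nlinarith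

/-- Real part of the numerator `1 - p ω̄`, `ω̄ = 1/2 - i√3/2`. -/
private lemma am_num_re (p : ℂ) :
    (1 - p * (⟨1 / 2, -(Real.sqrt 3 / 2)⟩ : ℂ)).re = 1 - p.re / 2 - Real.sqrt 3 / 2 * p.im := by
  simp [Complex.mul_re]; ring

/-- Imaginary part of the numerator `1 - p ω̄`. -/
private lemma am_num_im (p : ℂ) :
    (1 - p * (⟨1 / 2, -(Real.sqrt 3 / 2)⟩ : ℂ)).im = Real.sqrt 3 / 2 * p.re - p.im / 2 := by
  simp [Complex.mul_im]; ring

/-- Real part of the denominator `1 - p ω`, `ω = 1/2 + i√3/2`. -/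
private lemma am_den_re (p : ℂ) :
    (1 - p * (⟨1 / 2, Real.sqrt 3 / 2⟩ : ℂ)).re = 1 - p.re / 2 + Real.sqrt 3 / 2 * p.im := by
  simp [Complex.mul_re]; ring

/-- Imaginary part of the denominator `1 - p ω`. -/
private lemma am_den_im (p : ℂ) :
    (1 - p * (⟨1 / 2, Real.sqrt 3 / 2⟩ : ℂ)).im = -(p.im / 2 + Real.sqrt 3 / 2 * p.re) := by
  simp [Complex.mul_im]; ring

/-- `im M = √3 (x - (x²+y²)/2) / |1 - p ω|²` for `M = (1 - p ω̄)/(1 - p ω)`. -/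
private lemma amM_im (p : ℂ) :
    ((1 - p * (⟨1 / 2, -(Real.sqrt 3 / 2)⟩ : ℂ)) / (1 - p * (⟨1 / 2, Real.sqrt 3 / 2⟩ : ℂ))).im =
      Real.sqrt 3 * (p.re - (p.re ^ 2 + p.im ^ 2) / 2) /
        Complex.normSq (1 - p * (⟨1 / 2, Real.sqrt 3 / 2⟩ : ℂ)) := by
  rw [Complex.div_im, div_sub_div_same, am_num_re, am_num_im, am_den_re, am_den_im]
  congr 1
  ring

/-- `re M = (1 - x - (x²+y²)/2) / |1 - p ω|²` for `M = (1 - p ω̄)/(1 - p ω)`. -/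
private lemma amM_re (p : ℂ) :
    ((1 - p * (⟨1 / 2, -(Real.sqrt 3 / 2)⟩ : ℂ)) / (1 - p * (⟨1 / 2, Real.sqrt 3 / 2⟩ : ℂ))).re =
      (1 - p.re - (p.re ^ 2 + p.im ^ 2) / 2) /
        Complex.normSq (1 - p * (⟨1 / 2, Real.sqrt 3 / 2⟩ : ℂ)) := by
  rw [Complex.div_re, ← add_div, am_num_re, am_num_im, am_den_re, am_den_im]
  congr 1
  linear_combination (-(p.re ^ 2 + p.im ^ 2) / 4) * sqrt3_sq

/-- On `D` the denominator `1 - p ω` does not vanish (its real part is positive). -/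
private lemma am_den_ne {p : ℂ} (hp : p ∈ Metric.ball ((1:ℂ) / 2) (1 / 2)) :
    1 - p * (⟨1 / 2, Real.sqrt 3 / 2⟩ : ℂ) ≠ 0 := by
  have hD := am_ball hp
  have hs := sqrt3_sq
  have hs0 := Real.sqrt_nonneg 3
  have hx : p.re < 1 := by nlinarith [sq_nonneg (p.re - 1), sq_nonneg p.im]
  have hy2 : p.im ^ 2 < 1 / 4 := by nlinarith [sq_nonneg (p.re - 1 / 2)]
  have hy : -(1 / 2) < p.im := by nlinarith [sq_nonneg (p.im + 1 / 2)]
  have hs2 : Real.sqrt 3 < 2 := by nlinarith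
  have hre : 0 < (1 - p * (⟨1 / 2, Real.sqrt 3 / 2⟩ : ℂ)).re := by
    rw [am_den_re]
    rcases le_or_gt 0 p.im with h | h
    · nlinarith [mul_nonneg hs0 h]
    · nlinarith [mul_pos (sub_pos.2 hs2) (neg_pos.2 h)]
  intro h
  rw [h] at hre
  simp at hre

/-- On `D`: `0 < im M` and `0 < √3 re M + im M` (i.e. `0 < arg M < 2π/3`) for
`M = (1 - p ω̄)/(1 - p ω)`. -/
private lemma amM_pos {p : ℂ} (hp : p ∈ Metric.ball ((1:ℂ) / 2) (1 / 2)) :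
    0 < ((1 - p * (⟨1 / 2, -(Real.sqrt 3 / 2)⟩ : ℂ)) /
          (1 - p * (⟨1 / 2, Real.sqrt 3 / 2⟩ : ℂ))).im ∧
      0 < Real.sqrt 3 * ((1 - p * (⟨1 / 2, -(Real.sqrt 3 / 2)⟩ : ℂ)) /
          (1 - p * (⟨1 / 2, Real.sqrt 3 / 2⟩ : ℂ))).re +
        ((1 - p * (⟨1 / 2, -(Real.sqrt 3 / 2)⟩ : ℂ)) /
          (1 - p * (⟨1 / 2, Real.sqrt 3 / 2⟩ : ℂ))).im := by
  have hD := am_ball hp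
  have hn : 0 < Complex.normSq (1 - p * (⟨1 / 2, Real.sqrt 3 / 2⟩ : ℂ)) :=
    Complex.normSq_pos.2 (am_den_ne hp)
  have h3 : 0 < Real.sqrt 3 := Real.sqrt_pos.2 (by norm_num)
  have hx0 : 0 < p.re := by nlinarith [sq_nonneg p.re, sq_nonneg p.im]
  have hx1 : p.re < 1 := by nlinarith [sq_nonneg (p.re - 1), sq_nonneg p.im]
  rw [amM_im, amM_re]
  constructor
  · exact div_pos (mul_pos h3 (by nlinarith)) hn
  · have e : Real.sqrt 3 * ((1 - p.re - (p.re ^ 2 + p.im ^ 2) / 2) /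
          Complex.normSq (1 - p * (⟨1 / 2, Real.sqrt 3 / 2⟩ : ℂ)))
        + Real.sqrt 3 * (p.re - (p.re ^ 2 + p.im ^ 2) / 2) /
          Complex.normSq (1 - p * (⟨1 / 2, Real.sqrt 3 / 2⟩ : ℂ))
        = Real.sqrt 3 * (1 - (p.re ^ 2 + p.im ^ 2)) /
          Complex.normSq (1 - p * (⟨1 / 2, Real.sqrt 3 / 2⟩ : ℂ)) := by
      ring
    rw [e]
    exact div_pos (mul_pos h3 (by nlinarith)) hn

/-- For `z` in the sector `0 < im z`, `0 < √3 re z + im z` (i.e. `0 < arg z < 2π/3`), the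
principal power `z^{3/2} = (exp (log z / 2))³` lies in the open upper half-plane. -/
private lemma am_pow_im_pos {z : ℂ} (hzim : 0 < z.im) (hzrot : 0 < Real.sqrt 3 * z.re + z.im) :
    0 < (Complex.exp (Complex.log z / 2) ^ 3).im := by
  set R := Complex.exp (Complex.log z / 2) with hRdef
  have hz0 : z ≠ 0 := fun h => by rw [h] at hzim; simp at hzim
  have harg0 : 0 < Complex.arg z := by
    rcases (Complex.arg_nonneg_iff.2 hzim.le).eq_or_lt with h | h
    · exact absurd (Complex.arg_eq_zero_iff.1 h.symm).2 hzim.ne'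
    · exact h
  have hargπ : Complex.arg z < Real.pi := Complex.arg_lt_pi_iff.2 (Or.inr hzim.ne')
  have hu : 0 < R.re := by
    rw [hRdef, Complex.exp_re, Complex.div_ofNat_re, Complex.div_ofNat_im, Complex.log_im]
    refine mul_pos (Real.exp_pos _) (Real.cos_pos_of_mem_Ioo ⟨?_, ?_⟩) <;>
      linarith [Real.pi_pos]
  have hv : 0 < R.im := by
    rw [hRdef, Complex.exp_im, Complex.div_ofNat_re, Complex.div_ofNat_im, Complex.log_im]
    refine mul_pos (Real.exp_pos _) (Real.sin_pos_of_pos_of_lt_pi ?_ ?_) <;> linarith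
  have hR2 : R ^ 2 = z := by
    rw [hRdef, ← Complex.exp_nat_mul]
    push_cast
    rw [show (2:ℂ) * (Complex.log z / 2) = Complex.log z by ring]
    exact Complex.exp_log hz0
  have hre : z.re = R.re * R.re - R.im * R.im := by
    have h := congrArg Complex.re hR2
    rw [pow_two, Complex.mul_re] at h
    exact h.symm
  have him : z.im = 2 * R.re * R.im := by
    have h := congrArg Complex.im hR2
    rw [pow_two, Complex.mul_im] at h
    linarith
  rw [hre, him] at hzrot
  have hs := sqrt3_sq
  have key : (Real.sqrt 3 * R.re - R.im) * (R.re + Real.sqrt 3 * R.im)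
      = Real.sqrt 3 * (R.re * R.re - R.im * R.im) + 2 * R.re * R.im := by
    linear_combination (R.re * R.im) * hs
  have hpos : 0 < R.re + Real.sqrt 3 * R.im :=
    add_pos_of_pos_of_nonneg hu (mul_nonneg (Real.sqrt_nonneg 3) hv.le)
  have h1 : 0 < Real.sqrt 3 * R.re - R.im := by
    by_contra hneg
    nlinarith [mul_nonneg (neg_nonneg.2 (not_lt.1 hneg)) hpos.le]
  have h2 : 0 < Real.sqrt 3 * R.re + R.im :=
    add_pos_of_nonneg_of_pos (mul_nonneg (Real.sqrt_nonneg 3) hu.le) hv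
  have hE : (R ^ 3).im = 3 * R.re ^ 2 * R.im - R.im ^ 3 := by
    rw [show R ^ 3 = R * R * R by ring]
    simp only [Complex.mul_im, Complex.mul_re]
    ring
  have key2 : 3 * R.re ^ 2 * R.im - R.im ^ 3
      = R.im * ((Real.sqrt 3 * R.re - R.im) * (Real.sqrt 3 * R.re + R.im)) := by
    linear_combination (-(R.re ^ 2 * R.im)) * hs
  rw [hE, key2]
  exact mul_pos hv (mul_pos h1 h2)

/-- For `E` in the open upper half-plane, `1 - E ≠ 0`. -/
private lemma am_one_sub_ne {E : ℂ} (hE : 0 < E.im) : (1 : ℂ) - E ≠ 0 := by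
  intro h
  have h' := congrArg Complex.im h
  rw [Complex.sub_im, Complex.one_im, Complex.zero_im] at h'
  linarith

/-- For `E` in the open upper half-plane, `(1 + E)/(1 - E)` is in the open upper half-plane. -/
private lemma am_moeb_im_pos {E : ℂ} (hE : 0 < E.im) : 0 < ((1 + E) / (1 - E)).im := by
  have hn : 0 < Complex.normSq (1 - E) := Complex.normSq_pos.2 (am_one_sub_ne hE)
  rw [Complex.div_im, div_sub_div_same]
  apply div_pos _ hn
  simp only [Complex.add_im, Complex.one_im, Complex.sub_re, Complex.one_re, Complex.add_re,
    Complex.sub_im]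
  nlinarith

/-- If `M` is differentiable at `p` with `M p` in the sector `0 < arg < 2π/3`, then
`T = (1 + E)/(1 - E)`, `E = (exp (log M / 2))³`, is differentiable at `p`. -/
private lemma amT_differentiableAt {M : ℂ → ℂ} {p : ℂ} (hM : DifferentiableAt ℂ M p)
    (hMim : 0 < (M p).im) (hMrot : 0 < Real.sqrt 3 * (M p).re + (M p).im) :
    DifferentiableAt ℂ (fun p => (1 + Complex.exp (Complex.log (M p) / 2) ^ 3) /
      (1 - Complex.exp (Complex.log (M p) / 2) ^ 3)) p := by
  have hslit : M p ∈ Complex.slitPlane := Complex.mem_slitPlane_iff.2 (Or.inr hMim.ne')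
  have hE : DifferentiableAt ℂ (fun p => Complex.exp (Complex.log (M p) / 2) ^ 3) p :=
    (((hM.clog hslit).div_const 2).cexp).pow 3
  exact (hE.const_add 1).div (hE.const_sub 1) (am_one_sub_ne (am_pow_im_pos hMim hMrot))

/-- Value of `M` on the critical segment: for `a ∈ (0, π/3)` and
`q = sin a / (sin a + sin (π/3 - a))`, `M q = (1 - q ω̄)/(1 - q ω) = e^{2ia}`. -/
private lemma amM_seg {q a : ℝ} (ha0 : 0 < a) (ha1 : a < Real.pi / 3)
    (hq : q = Real.sin a / (Real.sin a + Real.sin (Real.pi / 3 - a))) :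
    (1 - (q : ℂ) * (⟨1 / 2, -(Real.sqrt 3 / 2)⟩ : ℂ)) / (1 - (q : ℂ) * (⟨1 / 2, Real.sqrt 3 / 2⟩ : ℂ)) =
      Complex.exp ((2 * a : ℝ) * Complex.I) := by
  have hs : 0 < Real.sin a := Real.sin_pos_of_pos_of_lt_pi ha0 (by linarith [Real.pi_pos])
  have hs' : 0 < Real.sin (Real.pi / 3 - a) :=
    Real.sin_pos_of_pos_of_lt_pi (by linarith) (by linarith [Real.pi_pos])
  set S := Real.sin a + Real.sin (Real.pi / 3 - a) with hSdef
  have hS : 0 < S := add_pos hs hs'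
  have hqS : q * S = Real.sin a := by rw [hq]; exact div_mul_cancel₀ _ hS.ne'
  have hSval : S = Real.sin a / 2 + Real.sqrt 3 / 2 * Real.cos a := by
    rw [hSdef, Real.sin_sub, Real.sin_pi_div_three, Real.cos_pi_div_three]; ring
  have hq' : q * (Real.sin a / 2 + Real.sqrt 3 / 2 * Real.cos a) = Real.sin a := by
    rw [← hSval]; exact hqS
  have hden : (1 : ℂ) - (q : ℂ) * (⟨1 / 2, Real.sqrt 3 / 2⟩ : ℂ) ≠ 0 := by
    intro h
    have h' := congrArg Complex.re h
    rw [am_den_re, Complex.ofReal_re, Complex.ofReal_im, Complex.zero_re] at h'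
    have hq2 : q = 2 := by linarith
    rw [hq2] at hqS
    linarith
  have hcs := Real.sin_sq_add_cos_sq a
  rw [div_eq_iff hden]
  apply Complex.ext
  · simp only [Complex.mul_re, am_num_re, am_den_re, am_den_im, Complex.exp_ofReal_mul_I_re,
      Complex.exp_ofReal_mul_I_im, Complex.ofReal_re, Complex.ofReal_im, Real.cos_two_mul,
      Real.sin_two_mul]
    linear_combination (-2 * Real.sin a) * hq' + (q - 2) * hcs
  · simp only [Complex.mul_im, am_num_im, am_den_re, am_den_im, Complex.exp_ofReal_mul_I_re,
      Complex.exp_ofReal_mul_I_im, Complex.ofReal_re, Complex.ofReal_im, Real.cos_two_mul,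
      Real.sin_two_mul]
    linear_combination (2 * Real.cos a) * hq'

/-- Value of the Möbius map `(1 + E)/(1 - E)` at `E = e^{2iβ}`, `β ∈ (0, π/2)`: `i cot β`. -/
private lemma amT_seg {β : ℝ} (hβ0 : 0 < β) (hβ1 : β < Real.pi / 2) :
    (1 + Complex.exp ((2 * β : ℝ) * Complex.I)) / (1 - Complex.exp ((2 * β : ℝ) * Complex.I)) =
      Complex.I * ((Real.cos β / Real.sin β : ℝ) : ℂ) := by
  have hs : Real.sin β ≠ 0 := (Real.sin_pos_of_pos_of_lt_pi hβ0 (by linarith)).ne'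
  have hs2 : 0 < Real.sin (2 * β) := Real.sin_pos_of_pos_of_lt_pi (by linarith) (by linarith)
  have hne : (1 : ℂ) - Complex.exp ((2 * β : ℝ) * Complex.I) ≠ 0 := by
    intro h
    have h' := congrArg Complex.im h
    rw [Complex.sub_im, Complex.one_im, Complex.exp_ofReal_mul_I_im, Complex.zero_im] at h'
    linarith
  have hcs := Real.sin_sq_add_cos_sq β
  set k := Real.cos β / Real.sin β with hkdef
  have hk : k * Real.sin β = Real.cos β := div_mul_cancel₀ _ hs
  rw [div_eq_iff hne]
  apply Complex.ext
  · simp only [Complex.add_re, Complex.one_re, Complex.exp_ofReal_mul_I_re, Complex.mul_re,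
      Complex.mul_im, Complex.I_re, Complex.I_im, Complex.ofReal_re, Complex.ofReal_im,
      Complex.sub_re, Complex.sub_im, Complex.one_im, Complex.exp_ofReal_mul_I_im,
      Real.cos_two_mul, Real.sin_two_mul]
    linear_combination (-2 * Real.cos β) * hk
  · simp only [Complex.add_im, Complex.one_im, Complex.exp_ofReal_mul_I_im, Complex.mul_re,
      Complex.mul_im, Complex.I_re, Complex.I_im, Complex.ofReal_re, Complex.ofReal_im,
      Complex.sub_re, Complex.sub_im, Complex.one_re, Complex.exp_ofReal_mul_I_re,
      Real.cos_two_mul, Real.sin_two_mul]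
    linear_combination (-2 * Real.sin β) * hk + (2 * k) * hcs

/-- **The weight-to-modulus dictionary is a holomorphic map `D → ℍ`** (expanded form of the stub
`stub_angleMap` below): there is `T` holomorphic on `ball (1/2) (1/2)` with values in the open upper
half-plane and `T (criticalWeight (α/2)) = i·cot(α/2)` for every `α ∈ (0, π)` (namely
`T = (1 + M^{3/2})/(1 - M^{3/2})`, `M p = (1 - p ω̄)/(1 - p ω)`, `ω = e^{iπ/3}`). -/
theorem anisotropicAngleMap :
    ∃ T : ℂ → ℂ, DifferentiableOn ℂ T (Metric.ball ((1:ℂ) / 2) (1 / 2)) ∧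
      (∀ p ∈ Metric.ball ((1:ℂ) / 2) (1 / 2), 0 < (T p).im) ∧
      ∀ α ∈ Set.Ioo (0:ℝ) Real.pi, T ((Literature.Probability.LatticeModels.criticalWeight (α / 2) : ℝ) : ℂ) = Complex.I * ((Real.cos (α / 2) / Real.sin (α / 2) : ℝ) : ℂ) := by
  refine ⟨fun p : ℂ =>
    (1 + Complex.exp (Complex.log ((1 - p * (⟨1 / 2, -(Real.sqrt 3 / 2)⟩ : ℂ)) /
        (1 - p * (⟨1 / 2, Real.sqrt 3 / 2⟩ : ℂ))) / 2) ^ 3) /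
      (1 - Complex.exp (Complex.log ((1 - p * (⟨1 / 2, -(Real.sqrt 3 / 2)⟩ : ℂ)) /
        (1 - p * (⟨1 / 2, Real.sqrt 3 / 2⟩ : ℂ))) / 2) ^ 3), ?_, ?_, ?_⟩
  · intro p hp
    obtain ⟨hMim, hMrot⟩ := amM_pos hp
    have hM : DifferentiableAt ℂ (fun p : ℂ => (1 - p * (⟨1 / 2, -(Real.sqrt 3 / 2)⟩ : ℂ)) /
        (1 - p * (⟨1 / 2, Real.sqrt 3 / 2⟩ : ℂ))) p :=
      DifferentiableAt.div (by fun_prop) (by fun_prop) (am_den_ne hp)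
    exact (amT_differentiableAt hM hMim hMrot).differentiableWithinAt
  · intro p hp
    obtain ⟨hMim, hMrot⟩ := amM_pos hp
    exact am_moeb_im_pos (am_pow_im_pos hMim hMrot)
  · intro α hα
    obtain ⟨hα0, hαπ⟩ := hα
    have hcw : Literature.Probability.LatticeModels.criticalWeight (α / 2) =
        Real.sin (α / 3) / (Real.sin (α / 3) + Real.sin (Real.pi / 3 - α / 3)) := by
      have e1 : 2 * (α / 2) / 3 = α / 3 := by ring
      have e2 : (Real.pi - 2 * (α / 2)) / 3 = Real.pi / 3 - α / 3 := by ring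
      simp only [Literature.Probability.LatticeModels.criticalWeight, e1, e2]
    have hM := amM_seg (a := α / 3) (by linarith) (by linarith) hcw
    have him1 : -Real.pi < (((2 * (α / 3) : ℝ) : ℂ) * Complex.I).im := by
      simp only [Complex.mul_im, Complex.ofReal_re, Complex.ofReal_im, Complex.I_re,
        Complex.I_im, mul_one, mul_zero, add_zero]
      linarith [Real.pi_pos]
    have him2 : (((2 * (α / 3) : ℝ) : ℂ) * Complex.I).im ≤ Real.pi := by
      simp only [Complex.mul_im, Complex.ofReal_re, Complex.ofReal_im, Complex.I_re,
        Complex.I_im, mul_one, mul_zero, add_zero]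
      linarith
    have h3 : ((3 : ℕ) : ℂ) * ((((2 * (α / 3) : ℝ) : ℂ) * Complex.I) / 2) =
        ((2 * (α / 2) : ℝ) : ℂ) * Complex.I := by
      push_cast
      ring
    beta_reduce
    rw [hM, Complex.log_exp him1 him2, ← Complex.exp_nat_mul, h3]
    exact amT_seg (β := α / 2) (by linarith) (by linarith)

/-- Signature of `stub_angleMap`, verbatim the body of `Sig.stub_angleMap` of the registered skeleton of
crux `AnisotropicBoxCardy` (line `birth`), so that the stub lands under the registered header
`stub_angleMap : Sig.stub_angleMap` and closes the skeleton's stub by `exact` (the two `Sig`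
definitions are definitionally equal).  Kept `private` so that sibling stub files may carry their own
copy without a name clash on import; use `anisotropicAngleMap` for the expanded statement.  A statement
only: it is the type of `stub_angleMap` below and is asserted nowhere else. -/
private def Sig.stub_angleMap : Prop :=
  ∃ T : ℂ → ℂ, DifferentiableOn ℂ T (Metric.ball ((1:ℂ) / 2) (1 / 2)) ∧
    (∀ p ∈ Metric.ball ((1:ℂ) / 2) (1 / 2), 0 < (T p).im) ∧
    ∀ α ∈ Set.Ioo (0:ℝ) Real.pi, T ((Literature.Probability.LatticeModels.criticalWeight (α / 2) : ℝ) : ℂ) = Complex.I * ((Real.cos (α / 2) / Real.sin (α / 2) : ℝ) : ℂ)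

/-- **Stub `stub_angleMap`** (line `birth` of crux `AnisotropicBoxCardy`): there is `T` holomorphic on
`ball (1/2) (1/2)` with values in the open upper half-plane and
`T (criticalWeight (α/2)) = i·cot(α/2)` for every `α ∈ (0, π)` (see `anisotropicAngleMap`). -/
theorem stub_angleMap : Sig.stub_angleMap :=
  anisotropicAngleMap

end Summit.CriticalPhenomena.CardyFormulaZ2.Theorems
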